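import Literature.AlgebraicGeometry.GroupSchemes.IsIsoOrEtaleOfNatCard                  -- ★ p845072 (O-b1k): `isIso_or_etale_of_natCard`, `flat_hom_of_field'`, `hom_finrank_eq_finrank_alg`
import Literature.AlgebraicGeometry.GroupSchemes.ConnectedFactorsThroughUnitComponent     -- ★ p844725 (o-c2d): `existsUnique_fac_hom`, `isMonHom_of_comp`
import Literature.AlgebraicGeometry.GroupSchemes.UnitComponentOfFiniteGroupScheme         -- ★ (b1a): `exists_unitComponent`, `isFinite_and_flat_of_immersions`
import HarnessLib

/-!
# Closed subgroups of a finite group scheme over `k̄`, by point count: ONE point ⟹ it IS the unit component; as many points as the rank ⟹ ÉTALE;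
# the DICHOTOMY for subgroups stable under a set of endomorphisms acting simply on `G(k)` ([Tate 1997] (3.7))

Topic `Literature/AlgebraicGeometry/GroupSchemes`; namespace `Literature.AlgebraicGeometry.GroupSchemes`.  THEOREMS ONLY (no definition, no
named fact, no instance, no notation, no `sorry`).  Cell `hodgecm-mathlib`, P6 «MOD programme»: the GENERIC ENGINE of the DICT constructor (E-b)
`eq_kerF_or_isEtale` (F0P6c-plan (g0) CENSUS-DICT v4 §(E); deal «=» 15:13:16Z), moduli-free, in the P6b currency (`Over (Spec (.of k))`, `GrpObj`,
unit-component clause `IsMonHom j ∧ IsOpenImmersion j.left ∧ IsClosedImmersion j.left ∧ ConnectedSpace G₀.left`).  For `k` algebraically closed,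
`G` a finite group scheme over `k` with unit component `j : G₀ ↪ G`, and a closed subgroup scheme `c : H ↪ G`:
* (E-b-conn) `#H(k) = 1` and `dim_k Γ(H) = dim_k Γ(G₀)` ⟹ `H ≅ G₀` OVER `G` (μ3 ★ `connectedSpace_left_of_natCard_hom_eq_one`: one point ⇒ connected;
  ★ (o-c2d) `existsUnique_fac_hom`: a connected subgroup factors through the unit component; ★ (o-c2c) `Over.isIso_of_isClosedImmersion_of_finrank_eq`);
* (E-b-ét) `#H(k) = dim_k Γ(H)` ⟹ `H → Spec k` ÉTALE (★ (O-b1k) `isIso_or_etale_of_natCard` for `H` with its own unit component ★ `exists_unitComponent`);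
* HEAD (E-b): if a set of endomorphisms `β` of `G` acts on the abstract group `G(k) = (𝟙 ⟶ G)` with NO stable subgroup other than `⊥`, `⊤`, if
  `#G(k) = dim_k Γ(G₀) = dim_k Γ(H)` (print: `q = #𝒜[𝔴](κ̄) = rank ker F = rank H` at an ordinary point) and the points of `H` are `β`-stable in `G(k)`,
  then EITHER `H ≅ G₀` over `G` OR `H` is étale — DICT (b) up to HEART's identifications «`G₀ = ker F`» and «`𝒜[𝔴](κ̄) ≅ 𝒪⁄𝔴` simple».
The supersingular twin («two closed subgroups of the same rank in a connected layer of tangent rank `1` coincide») is ★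
`ConnectedLayerClosedSubgroups.exists_iso_of_finrank_alg_eq_of_connectedSpace`.  HC_CM is proved only modulo the printed citations until rung 0 closes;
nothing here is about HC.

THE PRINT.  [Tate1997FiniteFlatGroupSchemes] (3.7): `rank G = #G(k̄) · rank G⁰`; `G` is connected iff `G(k̄) = 1`, étale iff `G⁰ = 1`; a connected closed
subgroup lies in `G⁰`.  [StacksProject] Tag 02KA (equal-rank closed immersion of finite flat schemes is an isomorphism).

## References
* [Tate1997FiniteFlatGroupSchemes] J. Tate, *Finite flat group schemes*, in: Modular Forms and Fermat's Last Theorem (1997) — (3.7), p. 141.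
* [StacksProject] The Stacks Project — Tag 02KA, Tag 00U3.
-/

set_option autoImplicit false

-- Mathlib's `Over`/`Scheme` APIs are stated across semireducible wrappers (as in the ★ `GroupSchemes/*` files).
set_option backward.isDefEq.respectTransparency false

noncomputable section

universe u

open CategoryTheory CategoryTheory.Limits AlgebraicGeometry MonoidalCategory CartesianMonoidalCategory
open scoped MonObj

namespace Literature.AlgebraicGeometry.GroupSchemes

variable {k : Type u} [Field k]

/-! ## §1 Closed subgroup schemes are finite; sections of a closed subgroup embed -/

/-- A closed subscheme of a finite `k`-scheme is finite over `k`. [cite: StacksProject, Tag 02KA] -/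
theorem isFinite_hom_of_isClosedImmersion {H G : Over (Spec (.of k))} (c : H ⟶ G) [IsClosedImmersion c.left] [IsFinite G.hom] :
    IsFinite H.hom := by
  rw [← Over.w c]; infer_instance

/-- **The sections of a closed subgroup scheme `c : H ↪ G` embed into those of `G`**, `h ↦ h ≫ c`; the number of sections of `H` is the
cardinality of the image. [cite: Tate1997FiniteFlatGroupSchemes, (3.7)] -/
theorem natCard_hom_eq_natCard_range {H G : Over (Spec (.of k))} [GrpObj H] [GrpObj G] (c : H ⟶ G) [IsMonHom c]
    [IsClosedImmersion c.left] :
    Nat.card (𝟙_ (Over (Spec (.of k))) ⟶ H) =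
      Nat.card (MonoidHom.range (MonoidHom.mk' (fun h : 𝟙_ (Over (Spec (.of k))) ⟶ H => h ≫ c)
        (fun a b => MonObj.mul_comp a b c))) := by
  haveI : Mono c := Over.mono_of_mono_left c
  have hinj : Function.Injective (MonoidHom.mk' (fun h : 𝟙_ (Over (Spec (.of k))) ⟶ H => h ≫ c) (fun a b => MonObj.mul_comp a b c)) :=
    fun a b hab => (cancel_mono c).mp hab
  exact Nat.card_congr (MonoidHom.ofInjective hinj).toEquiv

/-! ## §2 (E-b-conn) one point and the rank of the unit component ⟹ the subgroup IS the unit component -/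

/-- **(E-b-conn) A CLOSED SUBGROUP WITH ONE POINT AND THE RANK OF `G⁰` IS `G⁰`.**  `k` algebraically closed, `G` a finite group scheme over `k`,
`j : G₀ ↪ G` a unit component (homomorphic open-and-closed immersion, `G₀` connected), `c : H ↪ G` a closed subgroup scheme with exactly one
section (`#H(k) = 1`) and `dim_k Γ(H) = dim_k Γ(G₀)`.  Then `H ≅ G₀` over `G`: `H` is connected (μ3), so `c` factors through `j` (★ (o-c2d)) by a
closed immersion of equal rank, an isomorphism (★ (o-c2c)).  DICT (b), branch «`H(κ̄) = 0` ⇒ `H = ker F`».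
[cite: Tate1997FiniteFlatGroupSchemes, (3.7)] [cite: StacksProject, Tag 02KA] -/
theorem exists_iso_comp_eq_of_natCard_hom_eq_one [IsAlgClosed k] {G G₀ H : Over (Spec (.of k))} [GrpObj G] [GrpObj G₀] [GrpObj H]
    [IsFinite G.hom] (j : G₀ ⟶ G) (hj : IsMonHom j ∧ IsOpenImmersion j.left ∧ IsClosedImmersion j.left ∧ ConnectedSpace ↥G₀.left)
    (c : H ⟶ G) [IsMonHom c] [IsClosedImmersion c.left] (h1 : Nat.card (𝟙_ (Over (Spec (.of k))) ⟶ H) = 1)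
    (hrank : Module.finrank k (AffineGroupScheme.Alg H) = Module.finrank k (AffineGroupScheme.Alg G₀)) :
    ∃ e : H ≅ G₀, e.hom ≫ j = c := by
  obtain ⟨hmon, hop, hcl, hconn⟩ := hj
  haveI := hmon; haveI := hop; haveI := hcl; haveI := hconn
  haveI : IsFinite H.hom := isFinite_hom_of_isClosedImmersion c
  haveI : IsFinite G₀.hom := (isFinite_and_flat_of_immersions j).1
  haveI : ConnectedSpace ↥H.left := connectedSpace_left_of_natCard_hom_eq_one k H inferInstance h1
  haveI : Nonempty ↥(𝟙_ (Over (Spec (.of k)))).left := inferInstanceAs (Nonempty (PrimeSpectrum k))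
  obtain ⟨h₀, hh₀, -⟩ := existsUnique_fac_hom j c
  -- `h₀` is a closed immersion (its composite with the closed immersion `j` is `c`)
  haveI : IsClosedImmersion (h₀.left ≫ j.left) := by rw [← Over.comp_left, hh₀]; infer_instance
  haveI : IsClosedImmersion h₀.left := IsClosedImmersion.of_comp_isClosedImmersion h₀.left j.left
  haveI : Flat G₀.hom := flat_hom_of_field' G₀
  haveI : Flat H.hom := flat_hom_of_field' H
  haveI : IsIso h₀ :=
    Literature.AlgebraicGeometry.Morphisms.Over.isIso_of_isClosedImmersion_of_finrank_eq h₀ fun s => by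
      rw [hom_finrank_eq_finrank_alg H s, hom_finrank_eq_finrank_alg G₀ s, hrank]
  exact ⟨asIso h₀, hh₀⟩

/-! ## §3 (E-b-ét) as many points as the rank ⟹ étale -/

/-- **(E-b-ét) A FINITE GROUP SCHEME WITH AS MANY POINTS AS ITS RANK IS ÉTALE** (`k` algebraically closed): `#H(k) = dim_k Γ(H)` ⟹ `H → Spec k` étale —
★ (O-b1k) `isIso_or_etale_of_natCard` for `H` and its own unit component (★ `exists_unitComponent`).  DICT (b), branch «`#H(κ̄) = q` ⇒ `H` étale».
[cite: Tate1997FiniteFlatGroupSchemes, (3.7)] [cite: StacksProject, Tag 00U3] -/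
theorem etale_of_natCard_hom_eq_finrank [IsAlgClosed k] (H : Over (Spec (.of k))) [GrpObj H] [IsFinite H.hom]
    (h : Nat.card (𝟙_ (Over (Spec (.of k))) ⟶ H) = Module.finrank k (AffineGroupScheme.Alg H)) : Etale H.hom := by
  haveI : IsAffine H.left := AffineGroupScheme.isAffine_left_of_isAffineHom H
  obtain ⟨H₀, _, j₀, hj₀⟩ := exists_unitComponent k H
  exact (isIso_or_etale_of_natCard k H H₀ j₀ inferInstance hj₀).2 h

/-! ## §4 HEAD (E-b): the dichotomy for subgroups stable under endomorphisms acting simply on `G(k)` -/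

/-- **(E-b) THE DICHOTOMY.**  `k` algebraically closed; `G` a finite group scheme over `k` with unit component `j : G₀ ↪ G`; `β i : G ⟶ G` (`i ∈ σ`) a set
of homomorphisms such that the abstract group `G(k) = (𝟙 ⟶ G)` has NO `β`-stable subgroup other than `⊥` and `⊤` (print: `𝒜_x̄[𝔴](κ̄) ≅ 𝒪⁄𝔴` is a
simple `𝒪`-module); `c : H ↪ G` a closed subgroup scheme whose points are `β`-stable in `G(k)`, with `#G(k) = dim_k Γ(G₀) = dim_k Γ(H)` (print: all
`= q` at an ordinary point).  Then EITHER `H ≅ G₀` over `G` (the image of `H(k)` is `⊥`: (E-b-conn)) OR `H → Spec k` is ÉTALE (the image is `⊤`: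
`#H(k) = #G(k) = dim_k Γ(H)`, (E-b-ét)).  DICT (b) `eq_kerF_or_isEtale` up to «`G₀ = ker F`».
[cite: Tate1997FiniteFlatGroupSchemes, (3.7)] [cite: StacksProject, Tag 02KA] -/
theorem exists_iso_comp_eq_or_etale_of_forall_stable [IsAlgClosed k] {G G₀ H : Over (Spec (.of k))} [GrpObj G] [GrpObj G₀] [GrpObj H]
    [IsFinite G.hom] (j : G₀ ⟶ G) (hj : IsMonHom j ∧ IsOpenImmersion j.left ∧ IsClosedImmersion j.left ∧ ConnectedSpace ↥G₀.left)
    (c : H ⟶ G) [IsMonHom c] [IsClosedImmersion c.left]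
    {σ : Type*} (β : σ → (G ⟶ G))
    (hsimple : ∀ S : Subgroup (𝟙_ (Over (Spec (.of k))) ⟶ G),
      (∀ i, ∀ g ∈ S, g ≫ β i ∈ S) → S = ⊥ ∨ S = ⊤)
    (hstab : ∀ (i : σ) (h : 𝟙_ (Over (Spec (.of k))) ⟶ H), ∃ h' : 𝟙_ (Over (Spec (.of k))) ⟶ H, h' ≫ c = (h ≫ c) ≫ β i)
    (hG : Nat.card (𝟙_ (Over (Spec (.of k))) ⟶ G) = Module.finrank k (AffineGroupScheme.Alg G₀))
    (hH : Module.finrank k (AffineGroupScheme.Alg H) = Module.finrank k (AffineGroupScheme.Alg G₀)) :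
    (∃ e : H ≅ G₀, e.hom ≫ j = c) ∨ Etale H.hom := by
  haveI : IsFinite H.hom := isFinite_hom_of_isClosedImmersion c
  -- the image of `H(k)` in `G(k)`
  let f : (𝟙_ (Over (Spec (.of k))) ⟶ H) →* (𝟙_ (Over (Spec (.of k))) ⟶ G) :=
    MonoidHom.mk' (fun h => h ≫ c) (fun a b => MonObj.mul_comp a b c)
  have hS : ∀ i, ∀ g ∈ f.range, g ≫ β i ∈ f.range := by
    rintro i _ ⟨h, rfl⟩
    obtain ⟨h', hh'⟩ := hstab i h
    exact ⟨h', hh'⟩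
  have hcard : Nat.card (𝟙_ (Over (Spec (.of k))) ⟶ H) = Nat.card f.range := natCard_hom_eq_natCard_range c
  rcases hsimple f.range hS with hbot | htop
  · left
    rw [hbot, Subgroup.card_bot] at hcard
    exact exists_iso_comp_eq_of_natCard_hom_eq_one j hj c hcard hH
  · right
    rw [htop, Subgroup.card_top, hG, ← hH] at hcard
    exact etale_of_natCard_hom_eq_finrank H hcard

end Literature.AlgebraicGeometry.GroupSchemes

end
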